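import Mathlib

/-!
# Abstract quaternion field switch · Veronese step (rational normal curve of degree `n`)

Helper file for the stub `stub_abstractSwitch` of the line `Sketch` (idea `dicyclic-quaternion-switch`)
for the crux `HeckePrymWeil.HyperbolicEightfoldsSqrtMinus7` (item stmt-HodgeConjecture-14642).

Pure multilinear algebra over a field `K`:

* `multilinear_pencil_expansion` : for a multilinear map `f` in `n` variables and two families
  `u w : Fin n → M`, the pencil `f (α • u + β • w)` is a binary form of degree `n` in `(α, β)` with
  vector coefficients: `f (α u + β w) = Σ_{j ≤ n} α^j β^(n-j) • E j`.
* `veronese_mem_span` : a vector-valued binary form `ω` of degree `n` takes ALL its values in the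
  span of its values at any `n + 1` pairwise non-proportional points `(a k, b k)` with `b k ≠ 0`
  (Vandermonde inversion): the rational normal curve of degree `n` spans, and is spanned by, any
  `n + 1` of its points.

These two facts give step (c) of the abstract switch: the line `⋀⁸(s ⊗ U) ⊂ ⋀⁸(S ⊗ U)` of every
point `s` of `S = ℂ²` lies in the span of the lines of nine pairwise non-proportional points.
-/

-- `Summit.HodgeConjecture.HodgeConjecture.…` is the tree's mandated namespace (summit = problem name).
set_option linter.dupNamespace false

namespace Summit.HodgeConjecture.HodgeConjecture.Theorems.HyperbolicEightfoldsSqrtMinus7.DicyclicQuaternionSwitch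

open Finset

variable {K M N : Type*} [Field K] [AddCommGroup M] [Module K M] [AddCommGroup N] [Module K N]

/-- **Binomial expansion of a multilinear map along a pencil.**  For a multilinear map `f` in `n`
variables and families `u w : Fin n → M` there are vectors `E 0, …, E n` with
`f (α • u + β • w) = Σ_{j=0}^{n} (α^j β^(n-j)) • E j` for all scalars `α, β`
(`E j = Σ_{#s = j} f (s.piecewise u w)`). [folklore] -/
theorem multilinear_pencil_expansion {n : ℕ} (f : MultilinearMap K (fun _ : Fin n => M) N)
    (u w : Fin n → M) :
    ∃ E : ℕ → N, ∀ α β : K,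
      f (fun i => α • u i + β • w i) = ∑ j ∈ range (n + 1), (α ^ j * β ^ (n - j)) • E j := by
  classical
  refine ⟨fun j => ∑ s ∈ (univ : Finset (Finset (Fin n))).filter (fun s => s.card = j),
    f (s.piecewise u w), fun α β => ?_⟩
  have h1 : (fun i => α • u i + β • w i) = (α • u) + (β • w) := rfl
  have h2 : ∀ s : Finset (Fin n),
      f (s.piecewise (α • u) (β • w)) = (α ^ s.card * β ^ (n - s.card)) • f (s.piecewise u w) := by
    intro s
    have hs : s.piecewise (α • u) (β • w) =
        fun i => (s.piecewise (fun _ => α) (fun _ => β) i) • (s.piecewise u w i) := by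
      ext i
      by_cases hi : i ∈ s <;> simp [hi]
    rw [hs, MultilinearMap.map_smul_univ, prod_piecewise, univ_inter, prod_const, prod_const]
    congr 2
    rw [sdiff_eq_inter_compl, univ_inter, card_compl, Fintype.card_fin]
  rw [h1, MultilinearMap.map_add_univ]
  simp_rw [h2]
  rw [← sum_fiberwise_of_maps_to (g := Finset.card) (t := range (n + 1)) (s := univ)
    (fun s _ => by simpa [Nat.lt_succ_iff] using card_le_univ s)]
  refine sum_congr rfl (fun j _ => ?_)
  rw [smul_sum]
  refine sum_congr rfl (fun s hs => ?_)
  rw [(mem_filter.1 hs).2]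

/-- **Veronese / Vandermonde step.**  Let `ω : K → K → N` be a vector-valued binary form of degree
`n`, `ω α β = Σ_{j=0}^{n} (α^j β^(n-j)) • E j`.  If `(a k, b k)`, `k = 0, …, n`, are `n + 1` points
with `b k ≠ 0` and pairwise distinct ratios `a k / b k` (pairwise non-proportional), then every value
`ω α β` lies in the `K`-span of the `n + 1` values `ω (a k) (b k)`.  Proof: the Vandermonde matrix
of the ratios is invertible, so each coefficient `E j` is a combination of the `ω (a k) (b k)`.
[folklore] -/
theorem veronese_mem_span :
    ∀ {K N : Type} [Field K] [AddCommGroup N] [Module K N] {n : ℕ} (ω : K → K → N) (E : ℕ → N),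
      (∀ α β, ω α β = ∑ j ∈ Finset.range (n + 1), (α ^ j * β ^ (n - j)) • E j) →
    ∀ (a b : Fin (n + 1) → K), (∀ k, b k ≠ 0) → Function.Injective (fun k => a k / b k) →
    ∀ α β : K, ω α β ∈ Submodule.span K (Set.range fun k => ω (a k) (b k)) := by
  intro K N _ _ _ n ω E hω a b hb hinj α β
  classical
  set P := Submodule.span K (Set.range fun k => ω (a k) (b k)) with hP
  set x : Fin (n + 1) → K := fun k => a k / b k with hx
  -- the dehomogenised values `y k = Σ_j x_k^j • E j = (b k ^ n)⁻¹ • ω (a k) (b k)` lie in `P`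
  have hy : ∀ k, ∑ j : Fin (n + 1), (x k ^ (j : ℕ)) • E j ∈ P := by
    intro k
    have hk : ∑ j : Fin (n + 1), (x k ^ (j : ℕ)) • E j = (b k ^ n)⁻¹ • ω (a k) (b k) := by
      rw [hω, sum_range (fun j => (a k ^ j * b k ^ (n - j)) • E j), smul_sum]
      refine sum_congr rfl (fun j _ => ?_)
      rw [smul_smul]
      congr 1
      have hj : (j : ℕ) + (n - j) = n := by have := j.2; omega
      have hbn : b k ^ n = b k ^ (j : ℕ) * b k ^ (n - j) := by rw [← pow_add, hj]
      have hbk := hb k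
      rw [hx, hbn]
      dsimp only
      rw [div_pow]
      field_simp
    rw [hk]
    exact P.smul_mem _ (Submodule.subset_span ⟨k, rfl⟩)
  -- Vandermonde inversion: every coefficient `E j`, `j ≤ n`, lies in `P`
  have hdet : IsUnit (Matrix.vandermonde x).det :=
    isUnit_iff_ne_zero.2 (Matrix.det_vandermonde_ne_zero_iff.2 hinj)
  have hE : ∀ j : Fin (n + 1), E j ∈ P := by
    intro j
    have key : E j = ∑ k, (Matrix.vandermonde x)⁻¹ j k • ∑ j' : Fin (n + 1), (x k ^ (j' : ℕ)) • E j' := by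
      simp_rw [smul_sum, smul_smul]
      rw [sum_comm]
      have h1 : ∀ j' : Fin (n + 1), ∑ k, ((Matrix.vandermonde x)⁻¹ j k * x k ^ (j' : ℕ)) • E j' =
          ((Matrix.vandermonde x)⁻¹ * Matrix.vandermonde x) j j' • E (j' : ℕ) := by
        intro j'
        rw [← sum_smul, Matrix.mul_apply]
        simp_rw [Matrix.vandermonde_apply]
      simp_rw [h1, Matrix.nonsing_inv_mul _ hdet, Matrix.one_apply, ite_smul, one_smul, zero_smul,
        sum_ite_eq, mem_univ, if_true]
    rw [key]
    exact P.sum_mem (fun k _ => P.smul_mem _ (hy k))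
  rw [hω, sum_range]
  exact P.sum_mem (fun j _ => P.smul_mem _ (hE j))

end Summit.HodgeConjecture.HodgeConjecture.Theorems.HyperbolicEightfoldsSqrtMinus7.DicyclicQuaternionSwitch
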